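import Mathlib
import HarnessLib
import Summits.ResolutionOfSingularities.ResolutionOfSingularities.Theorems.WildQuotientsWildQuotientResolutionConductorOneAction

/-!
# S2: consequences of the conductor-𝟙 law for an arbitrary `σ` (order `p`, the invariants `Tᵢ`)
(crux stmt-ResolutionOfSingularities-15640 `WildQuotients.WildQuotientResolution`, line `Sketch`;
chain w45c post-V5 programme S2, design `L/res-L1-w45c-lead-1/S2-DESIGN.md` §0/§6 F1 (second half).
[OURS · L1 W4.5c] — NOT a statement of the manuscript.)

The interface `ConductorOneCore p n` quantifies over ALL `σ : Aₙ ≃ₐ[k] Aₙ` with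
`σ(uᵢ)·(1 + uᵢ) = uᵢ`; by uniqueness (`ConductorOne.algHom_eq_coreSigmaHom_of_law`) such a `σ` is
the constructed `coreSigma`, whence: `eq_coreSigma_of_law`, `pow_p_eq_one_of_law` (`σ^p = 1`),
`map_coreU_sub_of_law` (`σ uᵢ − uᵢ = −uᵢ²·(1+uᵢ)⁻¹`), `ne_one_of_law` (`n ≥ 1`), `orderOf_of_law`,
`card_zpowers_of_law` (`|⟨σ⟩| = p`), `finite_zpowers_of_law`, and `map_coreT_of_law`
(`Tᵢ = uᵢ^p (1 − uᵢ^{p−1})⁻¹` is `σ`-invariant: `σ(1 − uᵢ^{p−1}) = vᵢ^p (1 − uᵢ^{p−1})` by the norm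
identity L1, `σ(uᵢ^p) = uᵢ^p vᵢ^p`, `vᵢ = (1+uᵢ)⁻¹`).
-/

-- single-problem summit: the doubled namespace component `ResolutionOfSingularities` is forced
set_option linter.dupNamespace false

noncomputable section

open MvPolynomial

namespace Summit.ResolutionOfSingularities.ResolutionOfSingularities.Theorems.WildQuotientResolution.ConductorOne

/-! ## Consequences for ANY `σ` with the law (the interface of `ConductorOneCore`) -/

section Law

variable (k : Type) [Field k] (p n : ℕ) [Fact p.Prime] [CharP k p]
variable (σ : CoreRing k p n ≃ₐ[k] CoreRing k p n)
  (hσ : ∀ i : Fin n, σ (coreU k p n i) * (1 + coreU k p n i) = coreU k p n i)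
include hσ

/-- Any `σ` with the law equals the constructed one. [OURS · L1 W4.5c] -/
theorem eq_coreSigma_of_law : σ = coreSigma k p n := by
  have h := algHom_eq_coreSigmaHom_of_law k p n (σ : CoreRing k p n →ₐ[k] CoreRing k p n) hσ
  apply AlgEquiv.ext
  intro x
  have hx := DFunLike.congr_fun h x
  exact hx

/-- `σ^p = 1` for any `σ` with the law. [OURS · L1 W4.5c] -/
theorem pow_p_eq_one_of_law : σ ^ p = 1 := by
  rw [eq_coreSigma_of_law k p n σ hσ]; exact coreSigma_pow_p k p n

/-- `σ uᵢ − uᵢ = −uᵢ²·(1+uᵢ)⁻¹`: the augmentation on coordinates. [OURS · L1 W4.5c] -/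
theorem map_coreU_sub_of_law (i : Fin n) :
    σ (coreU k p n i) - coreU k p n i =
      -(coreU k p n i ^ 2 * ↑((isUnit_one_add_coreU k p n i).unit⁻¹)) := by
  have hvu := coreInv_mul k p n i
  set u := coreU k p n i
  set v : CoreRing k p n := ↑((isUnit_one_add_coreU k p n i).unit⁻¹)
  have h1 : σ u = u * v := by
    have := hσ i
    calc σ u = σ u * ((1 + u) * v) := by rw [mul_comm (1 + u) v, hvu, mul_one]
      _ = (σ u * (1 + u)) * v := by ring
      _ = u * v := by rw [this]
  rw [h1]
  linear_combination u * hvu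

/-- `σ ≠ 1` as soon as `n ≥ 1` (`σ u₀ = u₀` would force `u₀² = 0`). [OURS · L1 W4.5c] -/
theorem ne_one_of_law (hn : 1 ≤ n) : σ ≠ 1 := by
  haveI := coreRing_isDomain k p n
  intro h1
  let i : Fin n := ⟨0, hn⟩
  have h := map_coreU_sub_of_law k p n σ hσ i
  rw [h1, AlgEquiv.one_apply, sub_self, eq_comm, neg_eq_zero] at h
  have hu2 : coreU k p n i ^ 2 = 0 := by
    have := congrArg (· * (1 + coreU k p n i)) h
    simp only [zero_mul, mul_assoc, coreInv_mul, mul_one] at this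
    exact this
  exact coreU_ne_zero k p n i (pow_eq_zero_iff (two_ne_zero) |>.mp hu2)

/-- `orderOf σ = p` for `n ≥ 1`. [OURS · L1 W4.5c] -/
theorem orderOf_of_law (hn : 1 ≤ n) : orderOf σ = p :=
  orderOf_eq_prime (pow_p_eq_one_of_law k p n σ hσ) (ne_one_of_law k p n σ hσ hn)

/-- `|⟨σ⟩| = p` for `n ≥ 1`. [OURS · L1 W4.5c] -/
theorem card_zpowers_of_law (hn : 1 ≤ n) : Nat.card (Subgroup.zpowers σ) = p := by
  rw [Nat.card_zpowers, orderOf_of_law k p n σ hσ hn]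

/-- `⟨σ⟩` is finite (any `n`). [OURS · L1 W4.5c] -/
theorem finite_zpowers_of_law (hn : 1 ≤ n) : Finite (Subgroup.zpowers σ) :=
  Nat.finite_of_card_ne_zero
    (by rw [card_zpowers_of_law k p n σ hσ hn]; exact (Fact.out : p.Prime).ne_zero)

/-- **`Tᵢ` is `σ`-invariant** (`σ(1 − uᵢ^{p−1}) = vᵢ^p (1 − uᵢ^{p−1})` by L1, `σ(uᵢ^p) = uᵢ^p vᵢ^p`).
[OURS · L1 W4.5c] -/
theorem map_coreT_of_law (i : Fin n) : σ (coreT k p n i) = coreT k p n i := by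
  have hvu := coreInv_mul k p n i
  have hL1 := core_norm_invariant k p n i
  set u := coreU k p n i with hu
  set v : CoreRing k p n := ↑((isUnit_one_add_coreU k p n i).unit⁻¹) with hv
  set T := coreT k p n i with hT
  have hp : p - 1 + 1 = p := Nat.sub_add_cancel (Fact.out : p.Prime).one_le
  have h1 : σ u = u * v := by
    have := hσ i
    calc σ u = σ u * ((1 + u) * v) := by rw [mul_comm (1 + u) v, hvu, mul_one]
      _ = (σ u * (1 + u)) * v := by ring
      _ = u * v := by rw [this]
  -- `σ(1 − u^{p−1}) = v^p (1 − u^{p−1})`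
  have h2 : σ (1 - u ^ (p - 1)) = v ^ p * (1 - u ^ (p - 1)) := by
    rw [map_sub, map_one, map_pow, h1, mul_pow]
    have e1 : v ^ (p - 1) * ((1 + u) ^ (p - 1) - u ^ (p - 1)) = 1 - u ^ (p - 1) * v ^ (p - 1) := by
      have : v ^ (p - 1) * (1 + u) ^ (p - 1) = 1 := by rw [← mul_pow, hvu, one_pow]
      rw [mul_sub, this]; ring
    have hvp : v ^ p = v ^ (p - 1) * v := by rw [← pow_succ, hp]
    have e2 : v ^ p * (1 - u ^ (p - 1)) =
        v ^ (p - 1) * (((1 + u) ^ (p - 1) - u ^ (p - 1)) * ((1 + u) * v)) := by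
      rw [hvp, ← hL1]; ring
    rw [e2, mul_comm (1 + u) v, hvu, mul_one, e1]
  -- multiply `σ T · σ(1 − u^{p−1}) = σ(u^p)` out
  have hTu : T * (1 - u ^ (p - 1)) = u ^ p := coreT_mul k p n i
  have h3 : σ T * (v ^ p * (1 - u ^ (p - 1))) = (u * v) ^ p := by
    rw [← h2, ← map_mul, hTu, map_pow, h1]
  have hvunit : IsUnit (v ^ p) := (Units.isUnit _).pow p
  have hfac : IsUnit (1 - u ^ (p - 1)) := isUnit_coreFactor k p n i
  have key : σ T * (v ^ p * (1 - u ^ (p - 1))) = T * (v ^ p * (1 - u ^ (p - 1))) := by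
    rw [h3, mul_pow, ← hTu]; ring
  exact (hvunit.mul hfac).mul_left_injective key

end Law

end Summit.ResolutionOfSingularities.ResolutionOfSingularities.Theorems.WildQuotientResolution.ConductorOne

end
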